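import Mathlib
import Summits.NavierStokesRegularity.NavierStokesRegularity.Theorems.HeteroclinicTriggerChainTriggerChainFrontStepTruncWindows
import HarnessLib

/-!
# `HeteroclinicTriggerChain` — crux `TriggerChainFrontStep` (item stmt-NavierStokesRegularity-22785):
  the DELAY PHASE of the hop, SHARP amplification budget — core step

Sharpening of `…TriggerChainFrontStepTruncDelayCore` for the seeded two-shell truncation
`x′ = −eu² − βuv`, `u′ = exu − guy`, `y′ = gu² − e′v²`, `v′ = βxu + e′yv`. In the first version the
amplification of the upper trigger by the receiver during the delay phase was booked at the constant rate
`2e′δ₂` with `δ₂ ≥ y(0) + gh²/e`, i.e. a factor `e^{2e′δ₂T}` over a window of length `T ≍ log(h/u(0))/e` —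
for the chain (`u(0) ≍ β`) this is `β^{−O(h²)}`, which is what forbids composing the delay phase at an
`O(1)` ignition level with the transfer phase (constants audit in the bus note of this seat, 2026-08-28).
But the receiver bound of `htcTP_receiver_window` is POINTWISE, `y(s) ≤ y(0) + g(u(s)² − u(0)²)/e`: the
self-generated receiver content tracks `u²`, whose time integral over the whole delay phase is only
`≍ h²/e`. Using the integrating factor `Ψ(s) = 2e′Y₀s + (e′g/e²)u(s)²` (`Y₀ ≥ y(0)` a bound for the INITIAL
residue), `Ψ′ ≥ e′y` along the window, so
* `htcTP_upper_bound_sharp`: `v(s) ≤ e^{Ψ(s)}(v(0) + 2βu(s)/e)` — only the initial residue `Y₀` is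
  amplified over the long delay; the `u²`-part contributes the bounded factor `e^{e′gh²/e²}`;
* `heteroclinicTriggerChain_trunc_delay_core_sharp`: the improvement step of the bootstrap with the weak
  receiver hypothesis in the form `y ≤ (g/e)u² + 2Y₀` and the SHARP budget
  `2Λ ≥ 2e′Y₀t + e′gh²/e²` replacing `Λ ≥ e′δ₂t`; all other hypotheses and conclusions as in the first
  version (plus the pointwise receiver bound among the conclusions).
The bootstrap and the ignition-time law with the sharp budget are in `…TruncPassageSharp`.

HONEST FRAMING: elementary facts about a four-dimensional quadratic ODE (a MODEL truncation of Tao's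
lattice, Tao 2016 §4); helper for the crux, no stub credit; nothing here is a statement about the
Navier–Stokes equations; no summit, rung or crux is proved. NS regularity is not proved by this line.
-/

noncomputable section

-- the sub-problem namespace `Summit.NavierStokesRegularity.NavierStokesRegularity` repeats the summit name by design (D-0017)
set_option linter.dupNamespace false

open Real Set

namespace Summit.NavierStokesRegularity.NavierStokesRegularity.Theorems

/-- **Centre drift of the upper trigger, sharp form.** If `v′ = βxu + e′yv`, `u′ = ru` with `r ≥ e/2`,
`x ≤ 1`, `u, v ≥ 0` and `y ≤ (g/e)u² + 2Y₀` on `[0, t]` (`g, Y₀ ≥ 0`), then with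
`Ψ(s) = 2e′Y₀s + (e′g/e²)u(s)²`: `v(s) ≤ e^{Ψ(s)} (v(0) + 2βu(s)/e)` on `[0, t]`
(`G = e·v·e^{−Ψ} − 2βu` is non-increasing, because `Ψ′ = 2e′Y₀ + (2e′g/e²)ru² ≥ e′y`). [folklore] -/
theorem htcTP_upper_bound_sharp {x u y v r : ℝ → ℝ} {β e e' g Y₀ : ℝ} (he : 0 < e) (hβ : 0 ≤ β)
    (he' : 0 ≤ e') (hg : 0 ≤ g) (hY₀ : 0 ≤ Y₀)
    (hv : ∀ s, HasDerivAt v (β * x s * u s + e' * y s * v s) s)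
    (hu' : ∀ s, HasDerivAt u (r s * u s) s) (hx1 : ∀ s, x s ≤ 1) (hunn : ∀ s, 0 ≤ u s)
    {t : ℝ} (hr : ∀ s ∈ Icc 0 t, e / 2 ≤ r s) (hvnn : ∀ s ∈ Icc 0 t, 0 ≤ v s)
    (hy2 : ∀ s ∈ Icc 0 t, y s ≤ g / e * u s ^ 2 + 2 * Y₀) :
    ∀ s ∈ Icc 0 t,
      v s ≤ Real.exp (2 * e' * Y₀ * s + e' * g / e ^ 2 * u s ^ 2) * (v 0 + 2 * β * u s / e) := by
  -- the integrating factor Ψ and E = exp(−Ψ)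
  have hu2 : ∀ s, HasDerivAt (fun q => u q ^ 2) (2 * u s * (r s * u s)) s := by
    intro s
    have h1 := (hu' s).mul (hu' s)
    have h2 : (fun q => u q ^ 2) = fun q => u q * u q := funext fun q => sq (u q)
    rw [h2]
    exact h1.congr_deriv (by ring)
  have hΨ : ∀ s, HasDerivAt (fun q => -(2 * e' * Y₀ * q + e' * g / e ^ 2 * u q ^ 2))
      (-(2 * e' * Y₀ * 1 + e' * g / e ^ 2 * (2 * u s * (r s * u s)))) s := fun s =>
    (((hasDerivAt_id' s).const_mul (2 * e' * Y₀)).add ((hu2 s).const_mul (e' * g / e ^ 2))).neg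
  have hG : ∀ s, HasDerivAt
      (fun q => e * (v q * Real.exp (-(2 * e' * Y₀ * q + e' * g / e ^ 2 * u q ^ 2))) - 2 * β * u q)
      (e * ((β * x s * u s + e' * y s * v s) * Real.exp (-(2 * e' * Y₀ * s + e' * g / e ^ 2 * u s ^ 2)) +
        v s * (Real.exp (-(2 * e' * Y₀ * s + e' * g / e ^ 2 * u s ^ 2)) *
          (-(2 * e' * Y₀ * 1 + e' * g / e ^ 2 * (2 * u s * (r s * u s)))))) -
        2 * β * (r s * u s)) s :=
    fun s => (((hv s).mul (hΨ s).exp).const_mul e).sub ((hu' s).const_mul _)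
  have hG' : ∀ s ∈ Icc 0 t,
      e * ((β * x s * u s + e' * y s * v s) * Real.exp (-(2 * e' * Y₀ * s + e' * g / e ^ 2 * u s ^ 2)) +
        v s * (Real.exp (-(2 * e' * Y₀ * s + e' * g / e ^ 2 * u s ^ 2)) *
          (-(2 * e' * Y₀ * 1 + e' * g / e ^ 2 * (2 * u s * (r s * u s)))))) -
        2 * β * (r s * u s) ≤ 0 := by
    intro s hs
    set E : ℝ := Real.exp (-(2 * e' * Y₀ * s + e' * g / e ^ 2 * u s ^ 2)) with hE
    have hE0 : 0 ≤ E := (Real.exp_pos _).le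
    have hE1 : E ≤ 1 := by
      rw [hE, Real.exp_le_one_iff, neg_nonpos]
      have := hs.1
      positivity
    have hus := hunn s
    have hvs := hvnn s hs
    have hrs := hr s hs
    -- seed term
    have t1 : β * x s * u s * E ≤ β * u s := by
      have h1 : β * x s * u s ≤ β * u s := by
        have h2 := mul_le_mul_of_nonneg_left (hx1 s) (mul_nonneg hβ hus)
        calc β * x s * u s = β * u s * x s := by ring
          _ ≤ β * u s * 1 := h2
          _ = β * u s := by ring
      calc β * x s * u s * E ≤ β * u s * E := mul_le_mul_of_nonneg_right h1 hE0
        _ ≤ β * u s * 1 := mul_le_mul_of_nonneg_left hE1 (mul_nonneg hβ hus)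
        _ = β * u s := by ring
    -- amplification term: e′y ≤ Ψ′
    have t2 : (e' * y s * v s +
        v s * (-(2 * e' * Y₀ * 1 + e' * g / e ^ 2 * (2 * u s * (r s * u s))))) * E ≤ 0 := by
      have h1 : e' * y s ≤ 2 * e' * Y₀ * 1 + e' * g / e ^ 2 * (2 * u s * (r s * u s)) := by
        have h2 : e' * y s ≤ e' * (g / e * u s ^ 2 + 2 * Y₀) := mul_le_mul_of_nonneg_left (hy2 s hs) he'
        have h3 : e' * (g / e * u s ^ 2) ≤ e' * g / e ^ 2 * (2 * u s * (r s * u s)) := by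
          have h4 : e' * g / e ^ 2 * (2 * u s * (r s * u s)) - e' * (g / e * u s ^ 2) =
              2 * (e' * g / e ^ 2) * u s ^ 2 * (r s - e / 2) := by
            field_simp
          have h5 : 0 ≤ 2 * (e' * g / e ^ 2) * u s ^ 2 * (r s - e / 2) := by
            have : 0 ≤ r s - e / 2 := by linarith
            positivity
          linarith
        linarith
      have h6 : (e' * y s * v s +
          v s * (-(2 * e' * Y₀ * 1 + e' * g / e ^ 2 * (2 * u s * (r s * u s))))) =
          -(v s * ((2 * e' * Y₀ * 1 + e' * g / e ^ 2 * (2 * u s * (r s * u s))) - e' * y s)) := by ring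
      rw [h6]
      have h7 : 0 ≤ v s * ((2 * e' * Y₀ * 1 + e' * g / e ^ 2 * (2 * u s * (r s * u s))) - e' * y s) :=
        mul_nonneg hvs (by linarith)
      exact mul_nonpos_iff.2 (Or.inr ⟨by linarith, hE0⟩)
    -- growth term
    have t3 : e * (β * u s) ≤ 2 * β * (r s * u s) := by
      have h1 : 2 * β * (r s * u s) - e * (β * u s) = 2 * (β * u s) * (r s - e / 2) := by ring
      have h2 : 0 ≤ 2 * (β * u s) * (r s - e / 2) :=
        mul_nonneg (mul_nonneg (by norm_num) (mul_nonneg hβ hus)) (by linarith)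
      linarith
    have h4 : e * ((β * x s * u s + e' * y s * v s) * E +
        v s * (E * (-(2 * e' * Y₀ * 1 + e' * g / e ^ 2 * (2 * u s * (r s * u s)))))) =
        e * (β * x s * u s * E) + e * ((e' * y s * v s +
          v s * (-(2 * e' * Y₀ * 1 + e' * g / e ^ 2 * (2 * u s * (r s * u s))))) * E) := by ring
    rw [h4]
    have h5 : e * (β * x s * u s * E) ≤ e * (β * u s) := mul_le_mul_of_nonneg_left t1 he.le
    have h6 : e * ((e' * y s * v s +
        v s * (-(2 * e' * Y₀ * 1 + e' * g / e ^ 2 * (2 * u s * (r s * u s))))) * E) ≤ 0 :=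
      mul_nonpos_iff.2 (Or.inl ⟨he.le, t2⟩)
    linarith
  have hGle := htcTP_le_of_deriv_nonpos hG hG'
  intro s hs
  have h1 := hGle s hs
  simp only [mul_zero, zero_add] at h1
  -- at time 0: E(0) ≤ 1, so the right-hand side is ≤ e v0
  have hE00 : Real.exp (-(e' * g / e ^ 2 * u 0 ^ 2)) ≤ 1 := by
    rw [Real.exp_le_one_iff, neg_nonpos]; positivity
  have h2 : e * (v s * Real.exp (-(2 * e' * Y₀ * s + e' * g / e ^ 2 * u s ^ 2))) ≤
      e * (v 0 + 2 * β * u s / e) := by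
    have h3 : e * (v 0 + 2 * β * u s / e) = e * v 0 + 2 * β * u s := by
      field_simp
    have h4 : 0 ≤ 2 * β * u 0 := by have := hunn 0; positivity
    have h5 : e * (v 0 * Real.exp (-(e' * g / e ^ 2 * u 0 ^ 2))) ≤ e * v 0 := by
      have h6 : v 0 * Real.exp (-(e' * g / e ^ 2 * u 0 ^ 2)) ≤ v 0 * 1 :=
        mul_le_mul_of_nonneg_left hE00 (hvnn 0 (left_mem_Icc.2 (hs.1.trans hs.2)))
      have h7 := mul_le_mul_of_nonneg_left h6 he.le
      linarith
    linarith
  have h5 : v s * Real.exp (-(2 * e' * Y₀ * s + e' * g / e ^ 2 * u s ^ 2)) ≤ v 0 + 2 * β * u s / e :=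
    le_of_mul_le_mul_left h2 he
  have h6 : v s = v s * Real.exp (-(2 * e' * Y₀ * s + e' * g / e ^ 2 * u s ^ 2)) *
      Real.exp (2 * e' * Y₀ * s + e' * g / e ^ 2 * u s ^ 2) := by
    rw [mul_assoc, ← Real.exp_add, neg_add_cancel, Real.exp_zero, mul_one]
  rw [h6, mul_comm (Real.exp (2 * e' * Y₀ * s + e' * g / e ^ 2 * u s ^ 2))]
  exact mul_le_mul_of_nonneg_right h5 (Real.exp_pos _).le

/-! ### The core step with the sharp budget -/

/-- **Delay phase, core step of the bootstrap, SHARP amplification budget.** In the seeded two-shell truncation with energy `≤ 1`,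
`u(0) > 0`, `y(0), v(0) ≥ 0`, on a window `[0, t]` where the trigger has not ignited (`u ≤ h`) and the
WEAK drift bounds `x ≥ 1 − 2δ₁`, `y ≤ (g/e)u² + 2Y₀` hold (`Y₀ ≥ y(0)`), the STRONG bounds hold:
`1 − δ₁ ≤ x ≤ 1`, `y(0) ≤ y ≤ δ₂`, `0 ≤ v ≤ e^{2Λ}(v(0) + 2βu/e)`, together with the two-sided
exponential law `u(0)e^{e(1−ε)s} ≤ u(s) ≤ u(0)e^{es}` (`ε = δ₁ + gδ₂/e`) and the collected seed
`v ≥ v(0) + β(1−δ₁)(u − u(0))/e`, and the pointwise receiver bound `y ≤ y(0) + g(u² − u(0)²)/e`.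
Constants: `δ₂ ≥ Y₀ + gh²/e`, SHARP budget `2Λ ≥ 2e′Y₀t + e′gh²/e²`,
`V ≥ e^{2Λ}(v(0) + 2βh/e)`, `δ₁ ≥ 1 − x(0) + h² + 2βVh/e`, smallness `2δ₁ + 2gδ₂/e ≤ 1/2`,
`4e′e^{4Λ}v(0)² ≤ g u(0)²`, `16e′β²e^{4Λ} ≤ g e²`. [folklore] -/
theorem heteroclinicTriggerChain_trunc_delay_core_sharp (e g e' β : ℝ) (he : 0 < e) (hg : 0 ≤ g)
    (he' : 0 ≤ e') (hβ : 0 ≤ β) (x u y v : ℝ → ℝ)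
    (hx : ∀ t, HasDerivAt x (-(e * u t ^ 2) - β * u t * v t) t)
    (hu : ∀ t, HasDerivAt u (e * x t * u t - g * u t * y t) t)
    (hy : ∀ t, HasDerivAt y (g * u t ^ 2 - e' * v t ^ 2) t)
    (hv : ∀ t, HasDerivAt v (β * x t * u t + e' * y t * v t) t)
    (hE : x 0 ^ 2 + u 0 ^ 2 + y 0 ^ 2 + v 0 ^ 2 ≤ 1)
    (hu0 : 0 < u 0) (hy0 : 0 ≤ y 0) (hv0 : 0 ≤ v 0)
    {h Λ δ₁ δ₂ V Y₀ t : ℝ} (hY₀ : y 0 ≤ Y₀)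
    (hδ₂ : Y₀ + g * h ^ 2 / e ≤ δ₂) (hΛt : 2 * e' * Y₀ * t + e' * g * h ^ 2 / e ^ 2 ≤ 2 * Λ)
    (hV : Real.exp (2 * Λ) * (v 0 + 2 * β * h / e) ≤ V)
    (hδ₁ : 1 - x 0 + h ^ 2 + 2 * β * V * h / e ≤ δ₁)
    (hsmall : 2 * δ₁ + 2 * g * δ₂ / e ≤ 1 / 2)
    (hv0u0 : 4 * e' * Real.exp (4 * Λ) * v 0 ^ 2 ≤ g * u 0 ^ 2)
    (hβe : 16 * e' * β ^ 2 * Real.exp (4 * Λ) ≤ g * e ^ 2)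
    (huh : ∀ s ∈ Icc 0 t, u s ≤ h)
    (hwx : ∀ s ∈ Icc 0 t, 1 - 2 * δ₁ ≤ x s) (hwy : ∀ s ∈ Icc 0 t, y s ≤ g / e * u s ^ 2 + 2 * Y₀) :
    ∀ s ∈ Icc 0 t,
      1 - δ₁ ≤ x s ∧ x s ≤ 1 ∧ y 0 ≤ y s ∧ y s ≤ δ₂ ∧ 0 < u s ∧ 0 ≤ v s ∧
      v s ≤ Real.exp (2 * Λ) * (v 0 + 2 * β * u s / e) ∧
      u 0 * Real.exp (e * (1 - (δ₁ + g * δ₂ / e)) * s) ≤ u s ∧ u s ≤ u 0 * Real.exp (e * s) ∧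
      v 0 + β * (1 - δ₁) * (u s - u 0) / e ≤ v s ∧
      y s ≤ y 0 + g * (u s ^ 2 - u 0 ^ 2) / e := by
  intro s₀ hs₀
  have ht : 0 ≤ t := hs₀.1.trans hs₀.2
  have h0mem : (0 : ℝ) ∈ Icc 0 t := left_mem_Icc.2 ht
  have hxc : Continuous x := continuous_iff_continuousAt.2 fun t => (hx t).continuousAt
  have hyc : Continuous y := continuous_iff_continuousAt.2 fun t => (hy t).continuousAt
  -- signs of the constants
  have hY₀nn : 0 ≤ Y₀ := hy0.trans hY₀
  have hδ₂nn : 0 ≤ δ₂ := by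
    have : 0 ≤ g * h ^ 2 / e := by
      have := sq_nonneg h
      positivity
    linarith
  have hsmall' : e * (2 * δ₁) + 2 * g * δ₂ ≤ e / 2 := by
    have h1 : e * (2 * δ₁ + 2 * g * δ₂ / e) ≤ e * (1 / 2) := mul_le_mul_of_nonneg_left hsmall he.le
    have h2 : e * (2 * δ₁ + 2 * g * δ₂ / e) = e * (2 * δ₁) + 2 * g * δ₂ := by
      field_simp
    linarith
  have h2δ₁ : 2 * δ₁ ≤ 1 / 2 := by
    have : 0 ≤ 2 * g * δ₂ / e := by positivity
    linarith
  -- energy and the trigger sign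
  have hEs : ∀ s, x s ^ 2 + u s ^ 2 + y s ^ 2 + v s ^ 2 ≤ 1 := fun s => by
    rw [heteroclinicTriggerChain_trunc_energy e g e' β x u y v hx hu hy hv s]; exact hE
  have hxle : ∀ s, x s ≤ 1 := fun s => by
    have h1 : x s ^ 2 ≤ 1 := by linarith [hEs s, sq_nonneg (u s), sq_nonneg (y s), sq_nonneg (v s)]
    exact (abs_le.1 ((sq_le_one_iff_abs_le_one _).1 h1)).2
  have hupos : ∀ s, 0 < u s := fun s => by
    rw [heteroclinicTriggerChain_trunc_trigger_formula e g x u y hxc hyc hu s]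
    exact mul_pos hu0 (Real.exp_pos _)
  have hunn : ∀ s, 0 ≤ u s := fun s => (hupos s).le
  have hu' : ∀ s, HasDerivAt u ((e * x s - g * y s) * u s) s := fun s =>
    (hu s).congr_deriv (by ring)
  -- (1) weak-phase rate bound and `x ≥ 0`
  have hrate : ∀ s ∈ Icc 0 t, e / 2 ≤ e * x s - g * y s := by
    intro s hs
    have h1 : e * (1 - 2 * δ₁) ≤ e * x s := mul_le_mul_of_nonneg_left (hwx s hs) he.le
    have h2 : g * y s ≤ g * (g / e * u s ^ 2 + 2 * Y₀) := mul_le_mul_of_nonneg_left (hwy s hs) hg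
    have h3 : u s ^ 2 ≤ h ^ 2 := pow_le_pow_left₀ (hunn s) (huh s hs) 2
    have h4 : g * (g / e * u s ^ 2) ≤ g * (g / e * h ^ 2) :=
      mul_le_mul_of_nonneg_left (mul_le_mul_of_nonneg_left h3 (by positivity)) hg
    have h5 : 2 * g * δ₂ ≥ 2 * g * Y₀ + 2 * (g * (g / e * h ^ 2)) := by
      have h6 := mul_le_mul_of_nonneg_left hδ₂ (by positivity : (0 : ℝ) ≤ 2 * g)
      have h7 : 2 * g * (Y₀ + g * h ^ 2 / e) = 2 * g * Y₀ + 2 * (g * (g / e * h ^ 2)) := by ring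
      linarith
    have h8 : 0 ≤ g * (g / e * h ^ 2) := by positivity
    linarith
  have hxnn : ∀ s ∈ Icc 0 t, 0 ≤ x s := fun s hs => by linarith [hwx s hs]
  -- (2) trigger non-decreasing, upper trigger nonnegative and bounded
  have humono := htcTP_mono_of_rate_nonneg hu' hunn (t := t) fun s hs => by linarith [hrate s hs]
  have hvnn : ∀ s ∈ Icc 0 t, 0 ≤ v s :=
    htcTP_upper_nonneg hv hyc (fun s hs => mul_nonneg (mul_nonneg hβ (hxnn s hs)) (hunn s)) hv0
  have hvub0 := htcTP_upper_bound_sharp he hβ he' hg hY₀nn hv hu' hxle hunn hrate hvnn hwy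
  have hvub : ∀ s ∈ Icc 0 t, v s ≤ Real.exp (2 * Λ) * (v 0 + 2 * β * u s / e) := by
    intro s hs
    have h1 := hvub0 s hs
    have h2 : 2 * e' * Y₀ * s + e' * g / e ^ 2 * u s ^ 2 ≤ 2 * Λ := by
      have h4 : 2 * e' * Y₀ * s ≤ 2 * e' * Y₀ * t := mul_le_mul_of_nonneg_left hs.2 (by positivity)
      have h5 : u s ^ 2 ≤ h ^ 2 := pow_le_pow_left₀ (hunn s) (huh s hs) 2
      have h6 : e' * g / e ^ 2 * u s ^ 2 ≤ e' * g / e ^ 2 * h ^ 2 :=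
        mul_le_mul_of_nonneg_left h5 (by positivity)
      have h7 : e' * g / e ^ 2 * h ^ 2 = e' * g * h ^ 2 / e ^ 2 := by ring
      linarith
    have h3 : 0 ≤ v 0 + 2 * β * u s / e := by
      have := hunn s
      positivity
    exact h1.trans (mul_le_mul_of_nonneg_right (Real.exp_le_exp.2 h2) h3)
  have hvV : ∀ s ∈ Icc 0 t, v s ≤ V := by
    intro s hs
    refine (hvub s hs).trans (le_trans ?_ hV)
    apply mul_le_mul_of_nonneg_left _ (Real.exp_pos _).le
    have : 2 * β * u s / e ≤ 2 * β * h / e :=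
      div_le_div_of_nonneg_right (mul_le_mul_of_nonneg_left (huh s hs) (by positivity)) he.le
    linarith
  have hVnn : 0 ≤ V := (hvnn 0 h0mem).trans (hvV 0 h0mem)
  -- (3) the upper drain is dominated by the pump
  have hdrain : ∀ s ∈ Icc 0 t, e' * v s ^ 2 ≤ g * u s ^ 2 := by
    intro s hs
    have hvs := hvnn s hs
    have hvu := hvub s hs
    have hum := humono s hs
    have hA2 : Real.exp (2 * Λ) ^ 2 = Real.exp (4 * Λ) := by
      rw [sq, ← Real.exp_add]; congr 1; ring
    have h1 : v s ^ 2 ≤ Real.exp (4 * Λ) * (v 0 + 2 * β * u s / e) ^ 2 := by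
      have := pow_le_pow_left₀ hvs hvu 2
      rw [mul_pow, hA2] at this
      exact this
    have h2 : (v 0 + 2 * β * u s / e) ^ 2 ≤ 2 * v 0 ^ 2 + 8 * β ^ 2 * u s ^ 2 / e ^ 2 := by
      have h3 : (v 0 + 2 * β * u s / e) ^ 2 ≤ 2 * v 0 ^ 2 + 2 * (2 * β * u s / e) ^ 2 := by
        have h3' : 2 * v 0 ^ 2 + 2 * (2 * β * u s / e) ^ 2 - (v 0 + 2 * β * u s / e) ^ 2 =
            (v 0 - 2 * β * u s / e) ^ 2 := by ring
        linarith [sq_nonneg (v 0 - 2 * β * u s / e)]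
      have h4 : 2 * (2 * β * u s / e) ^ 2 = 8 * β ^ 2 * u s ^ 2 / e ^ 2 := by
        field_simp
        ring
      linarith
    have h5 : e' * v s ^ 2 ≤ e' * Real.exp (4 * Λ) * (2 * v 0 ^ 2) +
        e' * Real.exp (4 * Λ) * (8 * β ^ 2 * u s ^ 2 / e ^ 2) := by
      have := mul_le_mul_of_nonneg_left (h1.trans (mul_le_mul_of_nonneg_left h2 (Real.exp_pos _).le)) he'
      have h6 : e' * (Real.exp (4 * Λ) * (2 * v 0 ^ 2 + 8 * β ^ 2 * u s ^ 2 / e ^ 2)) =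
          e' * Real.exp (4 * Λ) * (2 * v 0 ^ 2) + e' * Real.exp (4 * Λ) * (8 * β ^ 2 * u s ^ 2 / e ^ 2) := by
        ring
      linarith
    have h6 : e' * Real.exp (4 * Λ) * (2 * v 0 ^ 2) ≤ g * u s ^ 2 / 2 := by
      have h7 : u 0 ^ 2 ≤ u s ^ 2 := pow_le_pow_left₀ hu0.le hum 2
      have h8 : g * u 0 ^ 2 ≤ g * u s ^ 2 := mul_le_mul_of_nonneg_left h7 hg
      linarith
    have h7 : e' * Real.exp (4 * Λ) * (8 * β ^ 2 * u s ^ 2 / e ^ 2) ≤ g * u s ^ 2 / 2 := by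
      have h8 : e' * Real.exp (4 * Λ) * (8 * β ^ 2 * u s ^ 2 / e ^ 2) =
          (16 * e' * β ^ 2 * Real.exp (4 * Λ)) * u s ^ 2 / (2 * e ^ 2) := by
        field_simp
        ring
      have h9 : g * u s ^ 2 / 2 = (g * e ^ 2) * u s ^ 2 / (2 * e ^ 2) := by
        field_simp
      rw [h8, h9]
      exact div_le_div_of_nonneg_right (mul_le_mul_of_nonneg_right hβe (sq_nonneg _)) (by positivity)
    linarith
  -- (4) receiver and carrier windows
  have hyw := htcTP_receiver_window he hg he' hy hu' hrate hdrain
  have hynn : ∀ s ∈ Icc 0 t, 0 ≤ y s := fun s hs => hy0.trans (hyw s hs).1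
  have hyub : ∀ s ∈ Icc 0 t, y s ≤ δ₂ := by
    intro s hs
    have h1 := (hyw s hs).2
    have h2 : u s ^ 2 ≤ h ^ 2 := pow_le_pow_left₀ (hunn s) (huh s hs) 2
    have h3 : g * (u s ^ 2 - u 0 ^ 2) / e ≤ g * h ^ 2 / e := by
      apply div_le_div_of_nonneg_right _ he.le
      apply mul_le_mul_of_nonneg_left _ hg
      linarith [sq_nonneg (u 0)]
    linarith
  have hxw := htcTP_carrier_window he hβ hVnn hx hu' hunn hrate hvV
  have hxlb : ∀ s ∈ Icc 0 t, 1 - δ₁ ≤ x s := by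
    intro s hs
    have h1 := hxw s hs
    have h2 : u s ^ 2 ≤ h ^ 2 := pow_le_pow_left₀ (hunn s) (huh s hs) 2
    have h3 : u s ^ 2 - u 0 ^ 2 ≤ h ^ 2 := by linarith [sq_nonneg (u 0)]
    have h4 : 2 * β * V * (u s - u 0) / e ≤ 2 * β * V * h / e := by
      apply div_le_div_of_nonneg_right _ he.le
      have : u s - u 0 ≤ h := by linarith [huh s hs, hu0]
      exact mul_le_mul_of_nonneg_left this (by positivity)
    linarith
  -- (5) strong rate bounds, exponential law, collected seed
  have hrate2 : ∀ s ∈ Icc 0 t, e * (1 - (δ₁ + g * δ₂ / e)) ≤ e * x s - g * y s := by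
    intro s hs
    have h1 : e * (1 - δ₁) ≤ e * x s := mul_le_mul_of_nonneg_left (hxlb s hs) he.le
    have h2 : g * y s ≤ g * δ₂ := mul_le_mul_of_nonneg_left (hyub s hs) hg
    have h3 : e * (1 - (δ₁ + g * δ₂ / e)) = e * (1 - δ₁) - g * δ₂ := by
      field_simp
      ring
    linarith
  have hrate3 : ∀ s ∈ Icc 0 t, e * x s - g * y s ≤ e := by
    intro s hs
    have h1 : e * x s ≤ e * 1 := mul_le_mul_of_nonneg_left (hxle s) he.le
    have h2 : 0 ≤ g * y s := mul_nonneg hg (hynn s hs)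
    linarith
  have hulb := htcTP_exp_growth_lower hu' hunn hrate2
  have huub := htcTP_exp_growth_upper hu' hunn hrate3
  have hδ₁le : δ₁ ≤ 1 := by linarith
  have hseed := htcTP_seed_window he hβ he' hδ₁le hv hu' hunn hrate3 hxlb hynn hvnn
  exact ⟨hxlb s₀ hs₀, hxle s₀, (hyw s₀ hs₀).1, hyub s₀ hs₀, hupos s₀, hvnn s₀ hs₀, hvub s₀ hs₀,
    hulb s₀ hs₀, huub s₀ hs₀, hseed s₀ hs₀, (hyw s₀ hs₀).2⟩

end Summit.NavierStokesRegularity.NavierStokesRegularity.Theorems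

end
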